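import Summits.QuantumFields.BalabanUV.T4Continuum.Support.NE7FlatSupLetterGeneral
import HarnessLib

/-!
# NE7FlatSupLetterCompact — THE FLAT SUP LETTER FOR A COMPACTLY SUPPORTED (NON-PERIODIC) DIRECTION: a bond field `Z` supported in the interior of a block-aligned cube satisfies
# `‖Z(y,κ)‖ ≤ M·(K·B + K′·D) + K″·w∕M` with `B ≥ sup‖curl₁Z‖`, `D ≥ sup‖div₁Z − c ∘ blk_M‖` (any coarse `c`), `w ≥ sup‖QbarIter L (k+1) 1 Z‖` — by PERIODIZATION onto the flat
# torus of the cube and gen 101's `NE7FlatSupLetterGeneral.sup_flat_general`; no torus is visible in the statement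

Cell `pub-balaban`, rung (B)+1 sub-cell t4, lineage `b2b-balaban-t4-ne7-p1`, generation 101 (CRUX PROVER NE7 #1 = OWNER of BINDER row NE7).  Memo
`t4/b2b-balaban-t4-ne7-p1-g101/ROAD-G101.md` §3 (brick (C1)+(E1) of THE CURVED SUP LETTER (L), memo ROAD-G100 §4 «torus placement»): the bootstrap's cut-off, gauged slice element
`Z = χ•Y^u` is supported in a box about the sup-attaining bond and is NOT periodic; this file places it on a torus ONCE AND FOR ALL, so that the assembly never mentions a torus.
THE PERIODIZATION.  Cube `Q = M•c′ + [0, M·N′)^{d+1}` (block-aligned, `M = L^{k+1}`), coordinatewise wrap `τ x i = c i + (x i − c i) mod (M·N′)` (`c = M•c′`), `Zper = Z ∘ τ` (periodic,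
`= Z` on `Q`).  THE ONE LEMMA (§2 `apply_wrap_add`): if `Z` vanishes off the `2m`-INTERIOR of `Q` then for every `p` and every displacement `|v|_∞ ≤ m`, `Z (τ (p + v)) = Z (τ p + v)` —
either no wrap-around occurs (`τ(p+v) = τ p + v`), or both points lie in a boundary layer where `Z` vanishes.  Every flat local operator is a polynomial in shifted values, so with `m = 2M`:
`curl₁ Zper z = curl₁ Z (τ z)`, `div₁ Zper x = div₁ Z (τ x)`, `blk_M (τ x) = blk_M (τ (M• blk_M x))`, and `QbarIter L (k+1) 1 Zper zc = QbarIter L (k+1) 1 Z (blk_M (τ (M•zc)))`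
(`QbarIter_flat`, `iterate_Qcoarse_apply`, `B7Prop4Flat.linQ_eq_sum`) (§3).  §4 applies `sup_flat_general` to `Zper` and reads it at a point of `Q`.
WHAT ([folklore]; 0 def, 0 sorry; dimension `d + 1`, `L ≥ 2`, every `k`).  §1 integer wrap lemmas (`wrap_mem`, `wrap_eq_self`, `wrap_add_mul`, `wrap_congr`, `wrap_add_of_interior`,
`interior_of_wrap_shift`, `wrap_blockAligned_add`).  §2 the vector wrap and `apply_wrap_add`.  §3 the three operator transfers.  §4 **`sup_flat_compact`**.
HONEST FRAMING (page 1): index bookkeeping + gen 101's flat letter; `U = 1`, linear; THE CURVED LETTER (L) IS NOT PROVED HERE (placement brick only); NOT (S1), NOT NE7; spine 0∕9;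
finite T⁴ rung (B)+1 — NOT infinite volume, NOT mass gap, NOT BetaPertH, NOT Clay.  Continuum YM on T⁴ ⇐ BetaPertH ∧ nine spine estimates (0/9 proved); BetaPertH ⇐ (D1) ∧ (D4) ∧
CAP+tail; G-an2-4 gates asym, D1 and NE2/3/4.
-/

set_option autoImplicit false

open scoped BigOperators Matrix.Norms.L2Operator
open Finset

namespace Summit.QuantumFields.BalabanUV.T4Continuum.NE7FlatSupLetterCompact

open Literature.MathematicalPhysics.QuantumFieldTheory.Balaban1983to89
open B7Prop1Explicit (Site e e_apply boxVec)
open B7Prop4Flat (linQ_eq_sum)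
open T4AveragingDeficitWall (curlAt)
open AveragingDeficitPeriodicCounting (IsPeriodicDir)
open BlockAveragePushDirSplit (flat)
open NE3CoercivityScaling (flatDiv)
open NE3TangentCovariantTower (QbarIter QbarIter_flat)
open NE3SmoothRightInverseFlat (iterate_Qcoarse_apply)
open NE3SmoothLiftCurl (curlAt_flat_eq)
open SmoothRefineBlocks (blk res blk_add_res res_nonneg res_lt blk_res_eq_of blk_res_smul)
open NE7FlatSupLetterGeneral (sup_flat_general)

noncomputable section

variable {d : ℕ} {n : Type*} [Fintype n] [DecidableEq n]

/-! ## §1 Integer wrap lemmas (`w a := c + (a − c) mod P`) -/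

section IntWrap

omit [Fintype n] [DecidableEq n]

/-- the wrap lands in `[c, c+P)`. [folklore] -/
theorem wrap_mem (c a : ℤ) {P : ℤ} (hP : 0 < P) : c ≤ c + (a - c) % P ∧ c + (a - c) % P < c + P := by
  constructor
  · linarith [Int.emod_nonneg (a - c) hP.ne']
  · linarith [Int.emod_lt_of_pos (a - c) hP]

/-- the wrap fixes `[c, c+P)`. [folklore] -/
theorem wrap_eq_self {c a P : ℤ} (h1 : c ≤ a) (h2 : a < c + P) : c + (a - c) % P = a := by
  rw [Int.emod_eq_of_lt (by linarith) (by linarith)]; ring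

/-- the wrap is `P`-periodic. [folklore] -/
theorem wrap_add_mul (c a q P : ℤ) : c + (a + P * q - c) % P = c + (a - c) % P := by
  rw [show a + P * q - c = (a - c) + P * q by ring, Int.add_mul_emod_self_left]

/-- the wrap of `a` is the wrap of its own wrap shifted: `w (w a + v) = w (a + v)`. [folklore] -/
theorem wrap_congr (c a v P : ℤ) : c + ((c + (a - c) % P) + v - c) % P = c + (a + v - c) % P := by
  have h := Int.emod_add_mul_ediv (a - c) P
  -- `a = c + (a-c)%P + P*((a-c)/P)`
  have e : a + v - c = ((c + (a - c) % P) + v - c) + P * ((a - c) / P) := by linarith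
  rw [e, Int.add_mul_emod_self_left]

/-- **NO WRAP-AROUND IN THE `m`-INTERIOR**: if `|v| ≤ m` and `w a ∈ [c + m, c + P − m)` then `w (a + v) = w a + v`. [folklore] -/
theorem wrap_add_of_interior {c a v P m : ℤ} (hv : |v| ≤ m) (hlo : c + m ≤ c + (a - c) % P) (hhi : c + (a - c) % P < c + P - m) :
    c + (a + v - c) % P = (c + (a - c) % P) + v := by
  have hv1 := (abs_le.mp hv).1
  have hv2 := (abs_le.mp hv).2
  rw [← wrap_congr c a v P]
  exact wrap_eq_self (by linarith) (by linarith)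

/-- **THE `2m`-INTERIOR IS REACHED ONLY FROM THE `m`-INTERIOR**: if `|v| ≤ m` (`P > 0`) and either `w (a+v)` or `w a + v` lies in `[c + 2m, c + P − 2m)`, then
`w a ∈ [c + m, c + P − m)`. [folklore] -/
theorem interior_of_wrap_shift {c a v P m : ℤ} (hv : |v| ≤ m)
    (h : (c + 2 * m ≤ c + (a + v - c) % P ∧ c + (a + v - c) % P < c + P - 2 * m) ∨
      (c + 2 * m ≤ (c + (a - c) % P) + v ∧ (c + (a - c) % P) + v < c + P - 2 * m)) :
    c + m ≤ c + (a - c) % P ∧ c + (a - c) % P < c + P - m := by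
  have hv1 := (abs_le.mp hv).1
  have hv2 := (abs_le.mp hv).2
  rcases h with ⟨h1, h2⟩ | ⟨h1, h2⟩
  · -- `w a = w (w(a+v) − v) = w(a+v) − v`
    have e : c + (a - c) % P = (c + (a + v - c) % P) - v := by
      have h3 := wrap_congr c (a + v) (-v) P
      rw [show a + v + -v = a by ring] at h3
      rw [← h3, ← sub_eq_add_neg]
      exact wrap_eq_self (by linarith) (by linarith)
    rw [e]; constructor <;> linarith
  · constructor <;> linarith

/-- **BLOCK-ALIGNED WRAPS COMMUTE WITH IN-BLOCK OFFSETS**: for `P = M·N′`, `c = M·c′`, `a = M·b` and `0 ≤ j < M`, `w (a + j) = w a + j`, and `w a` is a multiple of `M`. [folklore] -/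
theorem wrap_blockAligned_add {M N' : ℕ} (hM : 1 ≤ M) (hN : 1 ≤ N') (c' b j : ℤ) (hj0 : 0 ≤ j) (hj : j < M) :
    (M : ℤ) * c' + ((M : ℤ) * b + j - (M : ℤ) * c') % ((M : ℤ) * N') = ((M : ℤ) * c' + ((M : ℤ) * b - (M : ℤ) * c') % ((M : ℤ) * N')) + j ∧
    ∃ q : ℤ, (M : ℤ) * c' + ((M : ℤ) * b - (M : ℤ) * c') % ((M : ℤ) * N') = (M : ℤ) * q := by
  have hM0 : (0 : ℤ) < M := by exact_mod_cast (by omega : 0 < M)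
  have hN0 : (0 : ℤ) < N' := by exact_mod_cast (by omega : 0 < N')
  have hmul : ((M : ℤ) * b - (M : ℤ) * c') % ((M : ℤ) * N') = (M : ℤ) * ((b - c') % N') := by
    rw [← mul_sub, Int.mul_emod_mul_of_pos _ _ hM0]
  have hr0 : 0 ≤ (b - c') % N' := Int.emod_nonneg _ hN0.ne'
  have hr1 : (b - c') % N' + 1 ≤ N' := Int.emod_lt_of_pos _ hN0
  refine ⟨?_, ⟨c' + (b - c') % N', by rw [hmul]; ring⟩⟩
  have e : (M : ℤ) * b + j - (M : ℤ) * c' = (M : ℤ) * ((b - c') % N') + j + ((M : ℤ) * N') * ((b - c') / N') := by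
    have h := Int.emod_add_mul_ediv (b - c') N'
    have : (M : ℤ) * b - (M : ℤ) * c' = (M : ℤ) * (b - c') := by ring
    nlinarith [h]
  rw [e, Int.add_mul_emod_self_left, hmul]
  rw [Int.emod_eq_of_lt (by positivity) ?_]
  · ring
  · nlinarith

end IntWrap

/-! ## §2 The vector wrap and the one lemma -/

section Wrap

variable {M N' : ℕ} (c' : Site (d + 1))

omit [Fintype n] [DecidableEq n] in
/-- the wrap of `x` into the cube `M•c′ + [0, M·N′)^{d+1}` lies in the cube. [folklore] -/
theorem wrapV_mem (hM : 1 ≤ M) (hN : 1 ≤ N') (x : Site (d + 1)) (i : Fin (d + 1)) :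
    (M : ℤ) * c' i ≤ (M : ℤ) * c' i + (x i - (M : ℤ) * c' i) % ((M : ℤ) * N') ∧
      (M : ℤ) * c' i + (x i - (M : ℤ) * c' i) % ((M : ℤ) * N') < (M : ℤ) * c' i + (M : ℤ) * N' := by
  have hP : (0 : ℤ) < (M : ℤ) * N' := by
    have : 0 < M * N' := Nat.mul_pos (by omega) (by omega)
    exact_mod_cast this
  exact wrap_mem _ _ hP

/-- **THE ONE LEMMA**: if `Z` vanishes off the `2m`-interior of the cube then for every `p` and every `|v|_∞ ≤ m`, `Z (τ (p + v)) = Z (τ p + v)`. [folklore] -/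
theorem apply_wrap_add {β : Type*} [Zero β] {m : ℤ} (Z : Site (d + 1) → β)
    (hZ : ∀ x, (∃ i, ¬ ((M : ℤ) * c' i + 2 * m ≤ x i ∧ x i < (M : ℤ) * c' i + (M : ℤ) * N' - 2 * m)) → Z x = 0)
    (p v : Site (d + 1)) (hv : ∀ i, |v i| ≤ m) :
    Z (fun i => (M : ℤ) * c' i + ((p + v) i - (M : ℤ) * c' i) % ((M : ℤ) * N'))
      = Z ((fun i => (M : ℤ) * c' i + (p i - (M : ℤ) * c' i) % ((M : ℤ) * N')) + v) := by
  by_cases hint : ∀ i, (M : ℤ) * c' i + m ≤ (M : ℤ) * c' i + (p i - (M : ℤ) * c' i) % ((M : ℤ) * N') ∧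
      (M : ℤ) * c' i + (p i - (M : ℤ) * c' i) % ((M : ℤ) * N') < (M : ℤ) * c' i + (M : ℤ) * N' - m
  · -- no wrap-around: the two points coincide
    congr 1
    funext i
    simp only [Pi.add_apply]
    exact wrap_add_of_interior (hv i) (hint i).1 (hint i).2
  · -- a boundary coordinate: both points are outside the `2m`-interior
    push Not at hint
    obtain ⟨i, hi⟩ := hint
    have hout : ∀ (q : ℤ), ((M : ℤ) * c' i + 2 * m ≤ q ∧ q < (M : ℤ) * c' i + (M : ℤ) * N' - 2 * m) →
        (q = (M : ℤ) * c' i + ((p + v) i - (M : ℤ) * c' i) % ((M : ℤ) * N') ∨ q = ((M : ℤ) * c' i + (p i - (M : ℤ) * c' i) % ((M : ℤ) * N')) + v i) → False := by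
      intro q hq hq'
      have key : (M : ℤ) * c' i + m ≤ (M : ℤ) * c' i + (p i - (M : ℤ) * c' i) % ((M : ℤ) * N') ∧
          (M : ℤ) * c' i + (p i - (M : ℤ) * c' i) % ((M : ℤ) * N') < (M : ℤ) * c' i + (M : ℤ) * N' - m := by
        refine interior_of_wrap_shift (v := v i) (hv i) ?_
        rcases hq' with rfl | rfl
        · left; simpa only [Pi.add_apply] using hq
        · right; exact hq
      exact absurd key.2 (not_lt.mpr (hi key.1))
    rw [hZ _ ⟨i, fun h => hout _ h (Or.inl rfl)⟩, hZ _ ⟨i, fun h => hout _ h (Or.inr (by simp only [Pi.add_apply]))⟩]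

omit [Fintype n] [DecidableEq n] in
/-- the vector wrap is `(M·N′)`-periodic. [folklore] -/
theorem wrapV_add_period (M N' : ℕ) (x : Site (d + 1)) (t : Fin (d + 1)) :
    (fun i => (M : ℤ) * c' i + ((x + ((M * N' : ℕ) : ℤ) • e t) i - (M : ℤ) * c' i) % ((M : ℤ) * N'))
      = fun i => (M : ℤ) * c' i + (x i - (M : ℤ) * c' i) % ((M : ℤ) * N') := by
  funext i
  simp only [Pi.add_apply, Pi.smul_apply, smul_eq_mul]
  rw [show x i + ((M * N' : ℕ) : ℤ) * e t i - (M : ℤ) * c' i = (x i - (M : ℤ) * c' i) + ((M : ℤ) * N') * e t i by push_cast; ring,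
    Int.add_mul_emod_self_left]

omit [Fintype n] [DecidableEq n] in
/-- the wrap of a block-aligned point is block-aligned. [folklore] -/
theorem wrapV_aligned (hM : 1 ≤ M) (hN : 1 ≤ N') (b : Site (d + 1)) :
    ∃ q : Site (d + 1), (fun i => (M : ℤ) * c' i + (((M : ℤ) • b) i - (M : ℤ) * c' i) % ((M : ℤ) * N')) = (M : ℤ) • q := by
  have hM0z : (0 : ℤ) < M := by exact_mod_cast (by omega : 0 < M)
  have hex := fun i => (wrap_blockAligned_add (M := M) (N' := N') hM hN (c' i) (b i) 0 le_rfl hM0z).2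
  choose q hq using hex
  refine ⟨q, funext fun i => ?_⟩
  simp only [Pi.smul_apply, smul_eq_mul]
  exact hq i

omit [Fintype n] [DecidableEq n] in
/-- the wrap commutes with the in-block offset: `τ x = τ (M • blk_M x) + res_M x`, hence `blk_M (τ x) = blk_M (τ (M • blk_M x))`. [folklore] -/
theorem blk_wrapV (hM : 1 ≤ M) (hN : 1 ≤ N') (x : Site (d + 1)) :
    blk M (fun i => (M : ℤ) * c' i + (x i - (M : ℤ) * c' i) % ((M : ℤ) * N'))
      = blk M (fun i => (M : ℤ) * c' i + (((M : ℤ) • blk M x) i - (M : ℤ) * c' i) % ((M : ℤ) * N')) := by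
  have hsplit : (fun i => (M : ℤ) * c' i + (x i - (M : ℤ) * c' i) % ((M : ℤ) * N'))
      = (fun i => (M : ℤ) * c' i + (((M : ℤ) • blk M x) i - (M : ℤ) * c' i) % ((M : ℤ) * N')) + res M x := by
    funext i
    have hb := congr_fun (blk_add_res M x) i
    simp only [Pi.add_apply, Pi.smul_apply, smul_eq_mul] at hb ⊢
    have key := (wrap_blockAligned_add (M := M) (N' := N') hM hN (c' i) (blk M x i) (res M x i) (res_nonneg hM x i) (res_lt hM x i)).1
    rw [← hb]
    exact key
  obtain ⟨q, hq⟩ := wrapV_aligned (M := M) (N' := N') c' hM hN (blk M x)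
  rw [hsplit, hq, (blk_res_smul hM q).1]
  exact (blk_res_eq_of hM rfl (res_nonneg hM x) (res_lt hM x)).1

end Wrap

/-! ## §3 Flat local operators of a wrapped field (abstract wrap `τ` with the one lemma as hypothesis) -/

section Operators

variable {τ : Site (d + 1) → Site (d + 1)} {m : ℤ} {Z : Site (d + 1) → Fin (d + 1) → Matrix n n ℂ}

/-- the flat curl of `Z ∘ τ` is the flat curl of `Z` read through `τ` (`m ≥ 1`). [folklore] -/
theorem curlAt_flat_wrap (hm : 1 ≤ m) (hτ : ∀ p v : Site (d + 1), (∀ i, |v i| ≤ m) → Z (τ (p + v)) = Z (τ p + v)) (z : Site (d + 1)) (μ ν : Fin (d + 1)) :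
    curlAt (flat (d := d + 1) (n := n)) (fun x κ => Z (τ x) κ) z μ ν = curlAt (flat (d := d + 1) (n := n)) Z (τ z) μ ν := by
  have he : ∀ μ' : Fin (d + 1), ∀ i, |e μ' i| ≤ m := fun μ' i => by
    rw [e_apply]; split_ifs <;> simp <;> linarith
  rw [curlAt_flat_eq, curlAt_flat_eq, hτ z (e μ) (he μ), hτ z (e ν) (he ν)]

omit [Fintype n] [DecidableEq n] in
/-- the flat divergence of `Z ∘ τ` is the flat divergence of `Z` read through `τ` (`m ≥ 1`). [folklore] -/
theorem flatDiv_wrap (hm : 1 ≤ m) (hτ : ∀ p v : Site (d + 1), (∀ i, |v i| ≤ m) → Z (τ (p + v)) = Z (τ p + v)) (x : Site (d + 1)) :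
    flatDiv (fun y κ => Z (τ y) κ) x = flatDiv Z (τ x) := by
  have he : ∀ μ' : Fin (d + 1), ∀ i, |(-e μ') i| ≤ m := fun μ' i => by
    rw [Pi.neg_apply, abs_neg, e_apply]; split_ifs <;> simp <;> linarith
  simp only [flatDiv]
  refine Finset.sum_congr rfl fun μ _ => ?_
  rw [sub_eq_add_neg x (e μ), hτ x (-e μ) (he μ), ← sub_eq_add_neg]

/-- the straight block average of `Z ∘ τ` at `p` is that of `Z` at `τ p` (`m ≥ 2M − 2` suffices; we ask `2(M−1) ≤ m`). [folklore] -/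
theorem linQ_wrap {M : ℕ} (hm : 2 * ((M : ℤ) - 1) ≤ m) (hτ : ∀ p v : Site (d + 1), (∀ i, |v i| ≤ m) → Z (τ (p + v)) = Z (τ p + v))
    (p : Site (d + 1)) (κ : Fin (d + 1)) :
    B7Prop3Flat.linQ M (fun y κ' => Z (τ y) κ') p κ = B7Prop3Flat.linQ M Z (τ p) κ := by
  rw [linQ_eq_sum, linQ_eq_sum]
  refine Finset.sum_congr rfl fun r _ => ?_
  congr 1
  refine Finset.sum_congr rfl fun i _ => ?_
  have hv : ∀ j, |(boxVec M r + ((i : ℕ) : ℤ) • e κ) j| ≤ m := by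
    intro j
    have h1 : 0 ≤ (boxVec M r) j ∧ (boxVec M r) j ≤ (M : ℤ) - 1 := by
      simp only [boxVec]; constructor
      · positivity
      · have := (r j).isLt; omega
    have h2 : 0 ≤ (((i : ℕ) : ℤ) • e κ) j ∧ (((i : ℕ) : ℤ) • e κ) j ≤ (M : ℤ) - 1 := by
      have hi := i.isLt
      simp only [Pi.smul_apply, e_apply, smul_eq_mul]
      by_cases hj : j = κ
      · rw [if_pos hj, mul_one]; constructor <;> omega
      · rw [if_neg hj, mul_zero]; constructor <;> omega
    rw [Pi.add_apply, abs_le]; constructor <;> linarith [h1.1, h1.2, h2.1, h2.2]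
  rw [add_assoc, hτ p _ hv, ← add_assoc]

end Operators

/-! ## §4 The flat sup letter for a compactly supported direction -/

/-- **THE FLAT SUP LETTER FOR A COMPACTLY SUPPORTED DIRECTION** (dimension `d + 1`, `L ≥ 2`, every `k`; `M = L^{k+1}`): `∃ K K′ K″ > 0` (functions of `d`, `card n`) such that for every
block-aligned cube `M•c′ + [0, M·N′)^{d+1}` (`N′ ≥ 1`), every bond field `Z` vanishing off the `4M`-interior of the cube, every `B ≥ 0` bounding `‖curlAt 1 Z z μ ν‖` (`μ ≠ ν`), every coarse `c`
and `D` with `‖flatDiv Z x − c (blk_M x)‖ ≤ D`, and every `w` with `‖QbarIter L (k+1) 1 Z zc κ‖ ≤ w` (all `z`, `x`, `zc`): `‖Z y κ‖ ≤ M·(K·B + K′·D) + K″·w∕M` for every `y, κ`. [folklore] -/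
theorem sup_flat_compact [Nonempty n] :
    ∃ K : ℝ, 0 < K ∧ ∃ K' : ℝ, 0 < K' ∧ ∃ K'' : ℝ, 0 < K'' ∧ ∀ (L : ℕ), 2 ≤ L → ∀ (k : ℕ) (c' : Site (d + 1)) (N' : ℕ), 1 ≤ N' →
      ∀ (Z : Site (d + 1) → Fin (d + 1) → Matrix n n ℂ),
      (∀ x : Site (d + 1), (∃ i, ¬ (((L ^ (k + 1) : ℕ) : ℤ) * c' i + 4 * ((L ^ (k + 1) : ℕ) : ℤ) ≤ x i ∧
          x i < ((L ^ (k + 1) : ℕ) : ℤ) * c' i + ((L ^ (k + 1) : ℕ) : ℤ) * N' - 4 * ((L ^ (k + 1) : ℕ) : ℤ))) → Z x = 0) →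
      ∀ (B : ℝ), 0 ≤ B → (∀ (z : Site (d + 1)) (μ ν : Fin (d + 1)), μ ≠ ν → ‖curlAt (flat (d := d + 1) (n := n)) Z z μ ν‖ ≤ B) →
      ∀ (c : Site (d + 1) → Matrix n n ℂ) (D : ℝ), (∀ x, ‖flatDiv Z x - c (blk (L ^ (k + 1)) x)‖ ≤ D) →
      ∀ (w : ℝ), (∀ (zc : Site (d + 1)) (κ : Fin (d + 1)), ‖QbarIter L (k + 1) (flat (d := d + 1) (n := n)) Z zc κ‖ ≤ w) →
      ∀ (y : Site (d + 1)) (κ : Fin (d + 1)),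
        ‖Z y κ‖ ≤ (L : ℝ) ^ (k + 1) * (K * B + K' * D) + K'' * w / (L : ℝ) ^ (k + 1) := by
  obtain ⟨K, hK, K', hK', K'', hK'', h⟩ := sup_flat_general (d := d) (n := n)
  refine ⟨K, hK, K', hK', K'', hK'', fun L hL k c' N' hN Z hZ B hB0 hB c D hD w hw y κ => ?_⟩
  have hL1 : 1 ≤ L := by omega
  haveI : NeZero N' := ⟨by omega⟩
  have hM1 : 1 ≤ L ^ (k + 1) := Nat.one_le_pow _ _ hL1
  have hMz1 : (1 : ℤ) ≤ ((L ^ (k + 1) : ℕ) : ℤ) := by exact_mod_cast hM1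
  have hMr0 : (0 : ℝ) < (L : ℝ) ^ (k + 1) := by positivity
  have hD0 : 0 ≤ D := (norm_nonneg _).trans (hD 0)
  have hw0 : 0 ≤ w := (norm_nonneg _).trans (hw 0 ⟨0, by omega⟩)
  -- the wrap and the one lemma with `m = 2M`
  have hone : ∀ p v : Site (d + 1), (∀ i, |v i| ≤ 2 * ((L ^ (k + 1) : ℕ) : ℤ)) →
      Z (fun i => ((L ^ (k + 1) : ℕ) : ℤ) * c' i + ((p + v) i - ((L ^ (k + 1) : ℕ) : ℤ) * c' i) % (((L ^ (k + 1) : ℕ) : ℤ) * N'))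
        = Z ((fun i => ((L ^ (k + 1) : ℕ) : ℤ) * c' i + (p i - ((L ^ (k + 1) : ℕ) : ℤ) * c' i) % (((L ^ (k + 1) : ℕ) : ℤ) * N')) + v) :=
    fun p v hv => apply_wrap_add (M := L ^ (k + 1)) (N' := N') c' (m := 2 * ((L ^ (k + 1) : ℕ) : ℤ)) Z (fun x hx => hZ x (by
      obtain ⟨i, hi⟩ := hx
      exact ⟨i, fun hh => hi ⟨by linarith [hh.1], by linarith [hh.2]⟩⟩)) p v hv
  have h2M : (1 : ℤ) ≤ 2 * ((L ^ (k + 1) : ℕ) : ℤ) := by linarith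
  have hm : 2 * (((L ^ (k + 1) : ℕ) : ℤ) - 1) ≤ 2 * ((L ^ (k + 1) : ℕ) : ℤ) := by linarith
  -- the periodized field and its three data
  have hZpP : IsPeriodicDir (fun x κ' => Z (fun i => ((L ^ (k + 1) : ℕ) : ℤ) * c' i + (x i - ((L ^ (k + 1) : ℕ) : ℤ) * c' i) % (((L ^ (k + 1) : ℕ) : ℤ) * N')) κ')
      ((L ^ (k + 1) * N' : ℕ) : ℤ) := fun x t μ' => by
    dsimp only
    rw [wrapV_add_period c' (L ^ (k + 1)) N' x t]
  have hcurl : ∀ (z : Site (d + 1)) (μ ν : Fin (d + 1)), μ ≠ ν →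
      ‖curlAt (flat (d := d + 1) (n := n)) (fun x κ' => Z (fun i => ((L ^ (k + 1) : ℕ) : ℤ) * c' i + (x i - ((L ^ (k + 1) : ℕ) : ℤ) * c' i) % (((L ^ (k + 1) : ℕ) : ℤ) * N')) κ') z μ ν‖ ≤ B :=
    fun z μ ν hμν => by rw [curlAt_flat_wrap h2M hone]; exact hB _ μ ν hμν
  have hdiv : ∀ x, ‖flatDiv (fun x κ' => Z (fun i => ((L ^ (k + 1) : ℕ) : ℤ) * c' i + (x i - ((L ^ (k + 1) : ℕ) : ℤ) * c' i) % (((L ^ (k + 1) : ℕ) : ℤ) * N')) κ') x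
      - (fun b => c (blk (L ^ (k + 1)) (fun i => ((L ^ (k + 1) : ℕ) : ℤ) * c' i + ((((L ^ (k + 1) : ℕ) : ℤ) • b) i - ((L ^ (k + 1) : ℕ) : ℤ) * c' i) % (((L ^ (k + 1) : ℕ) : ℤ) * N'))))
        (blk (L ^ (k + 1)) x)‖ ≤ D := fun x => by
    rw [flatDiv_wrap h2M hone]
    dsimp only
    rw [← blk_wrapV c' hM1 hN x]
    exact hD _
  have hQ : ∀ (zc : Site (d + 1)) (κ' : Fin (d + 1)),
      ‖QbarIter L (k + 1) (flat (d := d + 1) (n := n)) (fun x κ' => Z (fun i => ((L ^ (k + 1) : ℕ) : ℤ) * c' i + (x i - ((L ^ (k + 1) : ℕ) : ℤ) * c' i) % (((L ^ (k + 1) : ℕ) : ℤ) * N')) κ') zc κ'‖ ≤ w := by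
    intro zc κ'
    obtain ⟨q, hq⟩ := wrapV_aligned (M := L ^ (k + 1)) (N' := N') c' hM1 hN zc
    rw [QbarIter_flat hL1 (k + 1), iterate_Qcoarse_apply, linQ_wrap hm hone, hq, ← iterate_Qcoarse_apply, ← QbarIter_flat hL1 (k + 1)]
    exact hw q κ'
  -- the general flat letter for the periodized field, read at `y`
  have key := h L hL k N' (fun x κ' => Z (fun i => ((L ^ (k + 1) : ℕ) : ℤ) * c' i + (x i - ((L ^ (k + 1) : ℕ) : ℤ) * c' i) % (((L ^ (k + 1) : ℕ) : ℤ) * N')) κ')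
    hZpP B hB0 hcurl
    (fun b => c (blk (L ^ (k + 1)) (fun i => ((L ^ (k + 1) : ℕ) : ℤ) * c' i + ((((L ^ (k + 1) : ℕ) : ℤ) • b) i - ((L ^ (k + 1) : ℕ) : ℤ) * c' i) % (((L ^ (k + 1) : ℕ) : ℤ) * N'))))
    D hdiv w hQ y κ
  by_cases hy : ∀ i, ((L ^ (k + 1) : ℕ) : ℤ) * c' i ≤ y i ∧ y i < ((L ^ (k + 1) : ℕ) : ℤ) * c' i + ((L ^ (k + 1) : ℕ) : ℤ) * N'
  · have hτy : (fun i => ((L ^ (k + 1) : ℕ) : ℤ) * c' i + (y i - ((L ^ (k + 1) : ℕ) : ℤ) * c' i) % (((L ^ (k + 1) : ℕ) : ℤ) * N')) = y :=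
      funext fun i => wrap_eq_self (hy i).1 (hy i).2
    rw [hτy] at key
    exact key
  · -- off the cube `Z` vanishes
    push Not at hy
    obtain ⟨i, hi⟩ := hy
    have hz : Z y = 0 := hZ y ⟨i, fun hh => by
      by_cases hlo : ((L ^ (k + 1) : ℕ) : ℤ) * c' i ≤ y i
      · have := hi hlo; nlinarith [hh.2]
      · push Not at hlo; nlinarith [hh.1]⟩
    rw [hz, Pi.zero_apply, norm_zero]
    positivity

end

end Summit.QuantumFields.BalabanUV.T4Continuum.NE7FlatSupLetterCompact
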